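import Mathlib
import HarnessLib
import Literature.MathematicalPhysics.QuantumLattice.HubbardOneParticleCost
import Literature.MathematicalPhysics.QuantumLattice.FermionQuasiFree

/-!
# Route `EnslavedA1g`, support `EnslavedA1gUpperSandwich` (item `stmt-HubbardSuperconductivity-0938`):
# one-electron removal algebra (helper file 2/4)

CAR bookkeeping for the "Euler removal" step of the pair chemical-potential window
`E(N, 0) ≤ E(N + 2, 0) + 8` used by the upper sandwich. For the Hubbard Hamiltonian
`H = hamiltonian G t U` on a finite graph:

* `hamiltonian_eq_dGamma_add` — `H = dΓ(h₀) + U D`, `h₀ = hubbardOneBody G t 0`,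
  `D = Σ_x n_{x↑} n_{x↓}`;
* `dGamma_hubbardOneBody_commutator_annihilation` — `[dΓ(h₀), c_{xσ}] = t Σ_{y ∼ x} c_{yσ}`;
* `interaction_commutator_annihilation` — `[D, c_{xσ}] = -n_{x,σ̄} c_{xσ}` (`σ̄ = σ + 1`);
* `hamiltonian_commutator_annihilation` — the sum of the two;
* `spinNumber_mulVec_of_isInSector`, `sum_star_annihilation_mulVec_dotProduct` — the spin-resolved
  number operators `N_σ = Σ_x n_{xσ}` act on Lieb's sector `(a, b)` by `a` resp. `b`, and
  `Σ_x ⟨c_{xσ} φ, c_{xσ} v⟩ = ⟨φ, N_σ v⟩`;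
* `IsInSector.annihilation_up`, `IsInSector.annihilation_down` — `c_{x↑}` maps the sector
  `(a + 1, b)` to `(a, b)`, `c_{x↓}` maps `(a, b + 1)` to `(a, b)`.

Sources: O. Bratteli, D. W. Robinson, *Operator Algebras and QSM II* §5.2.2 (CAR);
E. H. Lieb, PRL 62 (1989) 1201 (sectors `(N↑, N↓)`); F. H. L. Essler et al., *The
One-Dimensional Hubbard Model* (2005) §2.1. All folklore.
-/

noncomputable section

-- the mandated namespace `Summit.<Summit>.<Problem>.Theorems` repeats `HubbardSuperconductivity`
set_option linter.dupNamespace false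

namespace Summit.HubbardSuperconductivity.HubbardSuperconductivity.Theorems.EnslavedA1g.UpperSandwich

open Matrix Finset
open Literature.MathematicalPhysics.QuantumLattice
open scoped ComplexOrder

variable {Λ : Type*} [LinearOrder Λ] [Fintype Λ]

/-! ### Commutators of the Hubbard Hamiltonian with a single annihilator -/

section Commutators

variable (G : SimpleGraph Λ) [DecidableRel G.Adj]

/-- `H(t, U) = dΓ(h₀) + U · Σ_x n_{x↑} n_{x↓}` with `h₀ = hubbardOneBody G t 0` (the free part is
quadratic, `hamiltonianWith_zero_eq_dGamma`). BGM 2006 §2.1. [folklore] -/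
theorem hamiltonian_eq_dGamma_add (t U : ℝ) :
    hamiltonian G t U =
      dGamma (hubbardOneBody G t 0) + (U : ℂ) • ∑ x : Λ, numberOp x 0 * numberOp x 1 := by
  rw [← hamiltonianWith_zero_eq_dGamma, hamiltonianWith_zero]
  simp [hamiltonian]

omit [LinearOrder Λ] in
/-- Sums over the orbitals `Orb Λ = Λ ×ₗ Fin 2` as iterated sums over sites and spins. [folklore] -/
theorem sum_orb_eq {M : Type*} [AddCommMonoid M] (f : Orb Λ → M) :
    ∑ o, f o = ∑ y : Λ, ∑ τ : Fin 2, f (orb y τ) := by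
  rw [← Fintype.sum_prod_type', ← (toLex : Λ × Fin 2 ≃ Orb Λ).sum_comp]

/-- **`[dΓ(h₀), c_{xσ}] = t Σ_{y ∼ x} c_{yσ}`**: the hopping term turns an annihilator into the
sum of the annihilators at the neighbouring sites (same spin). Essler et al. (2005) §2.1;
Bratteli–Robinson II §5.2.1 (`[dΓ(h), c_j] = -Σ_k h_{jk} c_k`). [folklore] -/
theorem dGamma_hubbardOneBody_commutator_annihilation (t : ℝ) (x : Λ) (σ : Fin 2) :
    dGamma (hubbardOneBody G t 0) * annihilation (orb x σ) -
        annihilation (orb x σ) * dGamma (hubbardOneBody G t 0) =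
      (t : ℂ) • ∑ y : Λ, if G.Adj x y then annihilation (orb y σ) else 0 := by
  rw [dGamma_commutator_annihilation, sum_orb_eq, Finset.smul_sum]
  refine Finset.sum_congr rfl fun y _ => ?_
  have hcoef : ∀ τ : Fin 2, (-(hubbardOneBody G t 0)ᵀ) (orb y τ) (orb x σ) =
      if G.Adj x y ∧ σ = τ then (t : ℂ) else 0 := by
    intro τ
    simp only [Matrix.neg_apply, Matrix.transpose_apply, hubbardOneBody_apply, ofLex_toLex,
      Complex.ofReal_zero, ite_self, sub_zero]
    split_ifs <;> simp
  simp only [hcoef]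
  by_cases hxy : G.Adj x y
  · simp only [hxy, true_and, if_true, ite_smul, zero_smul, Finset.sum_ite_eq, Finset.mem_univ]
  · simp [hxy]

/-- `A B C - C (A B) = A (B C - C B) + (A C - C A) B` (derivation rule). [folklore] -/
theorem mul_mul_sub_mul_mul_eq {n : Type*} [Fintype n] (A B C : Matrix n n ℂ) :
    A * B * C - C * (A * B) = A * (B * C - C * B) + (A * C - C * A) * B := by
  noncomm_ring

/-- **`[Σ_a n_{a↑} n_{a↓}, c_{xσ}] = -n_{x,σ̄} c_{xσ}`** (`σ̄ = σ + 1` in `Fin 2`): removing an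
electron of spin `σ` at `x` lowers the interaction by the occupation of the opposite spin there.
Essler et al. (2005) §2.1, eq. (2.8). [folklore] -/
theorem interaction_commutator_annihilation (x : Λ) (σ : Fin 2) :
    (∑ a : Λ, numberOp a 0 * numberOp a 1) * annihilation (orb x σ) -
        annihilation (orb x σ) * ∑ a : Λ, numberOp a 0 * numberOp a 1 =
      -(numberOp x (σ + 1) * annihilation (orb x σ)) := by
  rw [Finset.sum_mul, Finset.mul_sum, ← Finset.sum_sub_distrib]
  have key : ∀ a : Λ, numberOp a 0 * numberOp a 1 * annihilation (orb x σ) -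
      annihilation (orb x σ) * (numberOp a 0 * numberOp a 1) =
        if a = x then -(numberOp x (σ + 1) * annihilation (orb x σ)) else 0 := by
    intro a
    have h0 := creation_mul_annihilation_commutator_annihilation (orb a 0) (orb a 0) (orb x σ)
    have h1 := creation_mul_annihilation_commutator_annihilation (orb a 1) (orb a 1) (orb x σ)
    rw [mul_mul_sub_mul_mul_eq]
    change numberOp a 0 * (creation (orb a 1) * annihilation (orb a 1) * annihilation (orb x σ) -
        annihilation (orb x σ) * (creation (orb a 1) * annihilation (orb a 1))) +
      (creation (orb a 0) * annihilation (orb a 0) * annihilation (orb x σ) -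
        annihilation (orb x σ) * (creation (orb a 0) * annihilation (orb a 0))) * numberOp a 1 = _
    rw [h0, h1]
    fin_cases σ
    · -- removing an up electron
      have hne : orb a 1 ≠ orb x 0 := fun h => by simpa using (orb_eq_orb_iff.1 h).2
      simp only [hne, if_false, mul_zero, zero_add, Fin.zero_eta, zero_add]
      by_cases hax : a = x
      · subst hax
        have hcomm := creation_mul_annihilation_commutator_annihilation
          (orb a 1) (orb a 1) (orb a 0)
        rw [if_neg hne, sub_eq_zero] at hcomm
        rw [if_pos rfl, if_pos rfl, neg_mul]
        change -(annihilation (orb a 0) * (creation (orb a 1) * annihilation (orb a 1))) =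
          -((creation (orb a 1) * annihilation (orb a 1)) * annihilation (orb a 0))
        rw [hcomm]
      · have hne' : orb a 0 ≠ orb x 0 := fun h => hax (orb_eq_orb_iff.1 h).1
        rw [if_neg hne', if_neg hax, zero_mul]
    · -- removing a down electron
      have hne : orb a 0 ≠ orb x 1 := fun h => by simpa using (orb_eq_orb_iff.1 h).2
      simp only [hne, if_false, zero_mul, add_zero, Fin.mk_one]
      by_cases hax : a = x
      · subst hax
        rw [if_pos rfl, if_pos rfl, mul_neg]
        rfl
      · have hne' : orb a 1 ≠ orb x 1 := fun h => hax (orb_eq_orb_iff.1 h).1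
        rw [if_neg hne', if_neg hax, mul_zero]
  simp only [key, Finset.sum_ite_eq', Finset.mem_univ, if_true]

/-- **`[H(t,U), c_{xσ}] = t Σ_{y ∼ x} c_{yσ} - U n_{x,σ̄} c_{xσ}`.** Essler et al. (2005) §2.1. [folklore] -/
theorem hamiltonian_commutator_annihilation (t U : ℝ) (x : Λ) (σ : Fin 2) :
    hamiltonian G t U * annihilation (orb x σ) - annihilation (orb x σ) * hamiltonian G t U =
      (t : ℂ) • (∑ y : Λ, if G.Adj x y then annihilation (orb y σ) else 0) -
        (U : ℂ) • (numberOp x (σ + 1) * annihilation (orb x σ)) := by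
  rw [hamiltonian_eq_dGamma_add, add_mul, mul_add, add_sub_add_comm,
    dGamma_hubbardOneBody_commutator_annihilation, smul_mul_assoc, mul_smul_comm, ← smul_sub,
    interaction_commutator_annihilation, smul_neg, sub_eq_add_neg]

end Commutators

/-! ### Spin-resolved number operators on Lieb's sectors -/

section SpinNumber

/-- `(Σ_x n_{xσ}) φ` in the occupation basis: multiplication by the number of spin-`σ`
electrons, i.e. by `#upPart s` (`σ = ↑`) resp. `#downPart s` (`σ = ↓`). Lieb, PRL 62 (1989)
1201, eq. (2). [folklore] -/
theorem spinNumber_mulVec_apply (σ : Fin 2) (φ : Fock (Orb Λ)) (s : Finset (Orb Λ)) :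
    ((∑ x : Λ, numberOp x σ) *ᵥ φ) s =
      ((Finset.univ.filter fun x : Λ => orb x σ ∈ s).card : ℂ) * φ s := by
  rw [Matrix.sum_mulVec, Finset.sum_apply]
  have h : ∀ x : Λ, (numberOp x σ *ᵥ φ) s = (if orb x σ ∈ s then 1 else 0) * φ s := fun x => by
    rw [show numberOp x σ = numberAt (orb x σ) from rfl, numberAt_eq_diagonal, mulVec_diagonal]
  simp only [h, ← Finset.sum_mul, Finset.sum_boole]

/-- On Lieb's sector `(a, b)` the spin-resolved number operators act by `a` (spin up) and `b`
(spin down). Lieb, PRL 62 (1989) 1201, eq. (2). [folklore] -/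
theorem spinNumber_mulVec_of_isInSector {a b : ℕ} {φ : Fock (Orb Λ)} (hφ : IsInSector a b φ)
    (σ : Fin 2) :
    (∑ x : Λ, numberOp x σ) *ᵥ φ = ((if σ = 0 then a else b : ℕ) : ℂ) • φ := by
  funext s
  rw [spinNumber_mulVec_apply, Pi.smul_apply, smul_eq_mul]
  by_cases hs : (upPart s).card = a ∧ (downPart s).card = b
  · fin_cases σ
    · simp only [Fin.zero_eta, Fin.isValue, if_true]
      rw [show (Finset.univ.filter fun x : Λ => orb x 0 ∈ s) = upPart s from rfl, hs.1]
    · simp only [Fin.mk_one, Fin.isValue, one_ne_zero, if_false]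
      rw [show (Finset.univ.filter fun x : Λ => orb x 1 ∈ s) = downPart s from rfl, hs.2]
  · rw [hφ s hs, mul_zero, mul_zero]

/-- The spin-resolved number operators are Hermitian. [folklore] -/
theorem spinNumber_isHermitian (σ : Fin 2) :
    (∑ x : Λ, numberOp x σ : Matrix (Finset (Orb Λ)) (Finset (Orb Λ)) ℂ).IsHermitian :=
  isHermitian_finset_sum Finset.univ fun x _ => numberAt_isHermitian (orb x σ)

/-- `Σ_x ⟨c_{xσ} φ, c_{xσ} v⟩ = ⟨φ, N_σ v⟩`, `N_σ = Σ_x n_{xσ}`. Bratteli–Robinson II §5.2.2. [folklore] -/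
theorem sum_star_annihilation_mulVec_dotProduct (σ : Fin 2) (φ v : Fock (Orb Λ)) :
    ∑ x : Λ, star (annihilation (orb x σ) *ᵥ φ) ⬝ᵥ (annihilation (orb x σ) *ᵥ v) =
      star φ ⬝ᵥ ((∑ x : Λ, numberOp x σ) *ᵥ v) := by
  rw [Matrix.sum_mulVec, dotProduct_sum]
  refine Finset.sum_congr rfl fun x _ => ?_
  rw [show numberOp x σ = creation (orb x σ) * annihilation (orb x σ) from rfl, ← mulVec_mulVec,
    ThermodynamicLimit.star_mulVec_dotProduct]
  rfl

/-- On Lieb's sector `(a, b)`: `Σ_x ⟨c_{xσ} φ, c_{xσ} v⟩ = n_σ ⟨φ, v⟩` with `n_↑ = a`, `n_↓ = b`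
(`N_σ` is Hermitian and `N_σ φ = n_σ φ`). Lieb, PRL 62 (1989) 1201. [folklore] -/
theorem sum_star_annihilation_mulVec_dotProduct_of_isInSector {a b : ℕ} {φ : Fock (Orb Λ)}
    (hφ : IsInSector a b φ) (σ : Fin 2) (v : Fock (Orb Λ)) :
    ∑ x : Λ, star (annihilation (orb x σ) *ᵥ φ) ⬝ᵥ (annihilation (orb x σ) *ᵥ v) =
      ((if σ = 0 then a else b : ℕ) : ℂ) * (star φ ⬝ᵥ v) := by
  rw [sum_star_annihilation_mulVec_dotProduct,
    ← conjTranspose_conjTranspose (∑ x : Λ, numberOp x σ : Matrix (Finset (Orb Λ)) (Finset (Orb Λ)) ℂ),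
    ← ThermodynamicLimit.star_mulVec_dotProduct, (spinNumber_isHermitian σ).eq,
    spinNumber_mulVec_of_isInSector hφ, star_smul, smul_dotProduct, smul_eq_mul, Complex.star_def,
    Complex.conj_natCast]

end SpinNumber

/-! ### Annihilators between Lieb's sectors -/

section Sectors

/-- `c_{x↓}` maps the sector `(a, b + 1)` into `(a, b)`. Lieb, PRL 62 (1989) 1201. [folklore] -/
theorem IsInSector.annihilation_down {a b : ℕ} {φ : Fock (Orb Λ)} (hφ : IsInSector a (b + 1) φ)
    (x : Λ) : IsInSector a b (annihilation (orb x 1) *ᵥ φ) := by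
  intro s hs
  rw [annihilation_mulVec_apply]
  by_cases hx : orb x 1 ∈ s
  · rw [if_neg (not_not.2 hx)]
  · rw [if_pos hx]
    have hx' : x ∉ downPart s := by simpa [mem_downPart] using hx
    have hins : insert (orb x 1) s = pairSet (upPart s) (insert x (downPart s)) := by
      conv_lhs => rw [← pairSet_upPart_downPart s]
      rw [pairSet_insert_one]
    have hnot : ¬((upPart (insert (orb x 1) s)).card = a ∧
        (downPart (insert (orb x 1) s)).card = b + 1) := by
      rw [hins, upPart_pairSet, downPart_pairSet, Finset.card_insert_of_notMem hx']
      intro h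
      exact hs ⟨h.1, by omega⟩
    rw [hφ _ hnot, mul_zero]

/-- `c_{x↑}` maps the sector `(a + 1, b)` into `(a, b)`. Lieb, PRL 62 (1989) 1201. [folklore] -/
theorem IsInSector.annihilation_up {a b : ℕ} {φ : Fock (Orb Λ)} (hφ : IsInSector (a + 1) b φ)
    (x : Λ) : IsInSector a b (annihilation (orb x 0) *ᵥ φ) := by
  intro s hs
  rw [annihilation_mulVec_apply]
  by_cases hx : orb x 0 ∈ s
  · rw [if_neg (not_not.2 hx)]
  · rw [if_pos hx]
    have hx' : x ∉ upPart s := by simpa [mem_upPart] using hx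
    have hins : insert (orb x 0) s = pairSet (insert x (upPart s)) (downPart s) := by
      conv_lhs => rw [← pairSet_upPart_downPart s]
      rw [pairSet_insert_zero]
    have hnot : ¬((upPart (insert (orb x 0) s)).card = a + 1 ∧
        (downPart (insert (orb x 0) s)).card = b) := by
      rw [hins, upPart_pairSet, downPart_pairSet, Finset.card_insert_of_notMem hx']
      intro h
      exact hs ⟨by omega, h.2⟩
    rw [hφ _ hnot, mul_zero]

/-- `c_{xσ}` maps the sector `(a + [σ = ↑], b + [σ = ↓])` into `(a, b)`. Lieb, PRL 62 (1989) 1201. [folklore] -/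
theorem IsInSector.annihilation_spin {a b : ℕ} (σ : Fin 2) {φ : Fock (Orb Λ)}
    (hφ : IsInSector (if σ = 0 then a + 1 else a) (if σ = 0 then b else b + 1) φ) (x : Λ) :
    IsInSector a b (annihilation (orb x σ) *ᵥ φ) := by
  fin_cases σ
  · simp only [Fin.zero_eta, Fin.isValue, if_true] at hφ
    exact IsInSector.annihilation_up hφ x
  · simp only [Fin.mk_one, Fin.isValue, one_ne_zero, if_false] at hφ
    exact IsInSector.annihilation_down hφ x

/-- The occupation basis vector `|α↑ ∪ β↓⟩` lies in the sector `(#α, #β)`; in particular every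
sector `(a, b)` with `a, b ≤ |Λ|` contains a nonzero vector. Lieb, PRL 62 (1989) 1201. [folklore] -/
theorem exists_ne_zero_isInSector {a b : ℕ} (ha : a ≤ Fintype.card Λ) (hb : b ≤ Fintype.card Λ) :
    ∃ φ : Fock (Orb Λ), φ ≠ 0 ∧ IsInSector a b φ := by
  classical
  obtain ⟨α, -, hα⟩ : ∃ α : Finset Λ, α ⊆ univ ∧ α.card = a :=
    Finset.exists_subset_card_eq (by rwa [Finset.card_univ])
  obtain ⟨β, -, hβ⟩ : ∃ β : Finset Λ, β ⊆ univ ∧ β.card = b :=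
    Finset.exists_subset_card_eq (by rwa [Finset.card_univ])
  refine ⟨Pi.single (pairSet α β) 1, ?_, ?_⟩
  · intro h
    have := congrFun h (pairSet α β)
    simp at this
  · intro s hs
    rw [Pi.single_apply, if_neg]
    rintro rfl
    exact hs ⟨by rw [upPart_pairSet, hα], by rw [downPart_pairSet, hβ]⟩

end Sectors

end Summit.HubbardSuperconductivity.HubbardSuperconductivity.Theorems.EnslavedA1g.UpperSandwich
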